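import Summits.QuantumFields.YangMills.Theorems.FlatTubeReductionNearRegionOfInnerRate
import Summits.QuantumFields.YangMills.Theorems.FlatTubeReductionGroundStateConcentration
import Summits.QuantumFields.YangMills.Theorems.FlatTubeReductionNearFlatNearRegionGlue
import Summits.QuantumFields.YangMills.Theorems.FemtoCutoffLadderFixedLatticeLawInnerRateBO
import HarnessLib

/-!
# Route `FlatTubeReduction`: K1 `NearFlatRatioLaw` (stmt-QuantumFields-24720) from the INNER NO-INTRUDER WITH RATE alone, hence from the
# Born–Oppenheimer data with rate `BORateAll` — VERBATIM the single registered stub `stub_boRate` of crux `FixedLatticeLaw` (stmt-QuantumFields-23943)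
# (rung R2b1 = RECORD-label femto gap; no summit statement is proved here)

Seat `ym-line-ftr-p1` g4 (prover).  LINE 2 of route `FlatTubeReduction` (K1 ⇐ K1a′ `PinnedTubeRatioLawW` 27141, or ⇐ the near-region law K1a″) carries
NO analytic debt of its own: the K1 ratio law for every tube state `ψ ⊥ Ω` follows from the MIN–MAX inner rate that the FixedLatticeLaw door
`FemtoCutoffLadder.innerRateAt_of_bo_pow 1` produces from the Born–Oppenheimer data with rate.  Composition of
`GroundConc.groundState_outer_mass_le` (concentration of the exact ground state, two-layer onion on RED's valley gain),
`GroundConc.nearRegionTubeRatioLawAt_of_innerRate` (the family `(cos Θ_{6ρ}Ω, ψ)` + locality + two-case endgame), the near-region dichotomy glue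
`nearFlatRatioLaw_of_nearRegionTubeRatioLaw` (g3, p619200) and the door (p599058).
* ★★★ `nearFlatRatioLaw_of_innerRate` — (∀ L ≥ 2, INNER RATE at k = 1, δ = β^{−1/40}) → `NearFlatRatioLaw`;
* ★★★ `nearFlatRatioLaw_of_boRate` — (∀ L ≥ 2, BO data with rate (P1)(P3)(P4)(P5)(P6) + floor, = the body of `Cruxes.FixedLatticeLaw.Rate.BORateAll`)
  → `NearFlatRatioLaw`; so `stub_boRate` closes K1 24720 by `exact nearFlatRatioLaw_of_boRate stub_boRate`, exactly as it closes 23943.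
HONEST FRAMING: glue; the Born–Oppenheimer data with rate is OPEN fixed-lattice semiclassics (RED's C4 with a rate); nothing here is infinite volume,
a continuum limit or the Clay mass gap.  No definitions, no named facts, no `sorry`.
References: M. Lüscher, NPB 219 (1983) 233 [cite: Luscher1983, §3]; Gustafson–Sigal [cite: GustafsonSigal2003, §11–§12]; Reed–Simon IV
[cite: ReedSimonIV1978, Thm. XIII.1].
-/

set_option autoImplicit false

noncomputable section

open MeasureTheory Real
open scoped BigOperators
open Literature.MathematicalPhysics.QuantumFieldTheory hiding SU2
open Literature.MathematicalPhysics.QuantumLattice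

namespace Summit.QuantumFields.YangMills.Theorems.FlatTubeReduction

open Summit.QuantumFields.YangMills.Theses.FlatTubeReduction
open Summit.QuantumFields.YangMills.Theorems.FemtoTransferGap
open Summit.QuantumFields.YangMills.Theorems.FemtoCutoffLadder

/-- ★★★ **K1 `NearFlatRatioLaw` from the INNER NO-INTRUDER WITH RATE alone**: if for every `L ≥ 2`, eventually in `β`, every physical 2-family supported in
`{∃ z, orbitDist (τ_z U) < β^{−1/40}}` with nondegenerate Gram matrix has a combination with `⟨ψ,Kψ⟩μ₀ ≤ e^{Cλ_b(L³β)²}μ₁λ₀‖ψ‖²` (the conclusion of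
`innerRateAt_of_bo_pow 1`, = the `L`-clause of `InnerRateAll` of crux 23943), then `NearFlatRatioLaw`. [cite: Luscher1983, §3] [cite: ReedSimonIV1978, Thm. XIII.1] -/
theorem nearFlatRatioLaw_of_innerRate
    (hI : ∀ (L : ℕ) [NeZero L], 2 ≤ L → ∃ C βI : ℝ, ∀ β : ℝ, βI ≤ β →
      ∀ F : Fin 2 → (GaugeConfig 3 L SU2 → ℝ), (∀ i, IsPhys (F i)) →
        (∀ i U, F i U ≠ 0 → ∃ z : Fin 3 → Bool, orbitDist (TT.twist3 z U) < powScale (1 / 40) β) →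
        (∀ a : Fin 2 → ℝ, a ≠ 0 → 0 < l2 (fun U => ∑ i, a i * F i U) (fun U => ∑ i, a i * F i U)) →
          ∃ a : Fin 2 → ℝ, a ≠ 0 ∧
            qform su2Rep β (fun U => ∑ i, a i * F i U) (fun U => ∑ i, a i * F i U) * levelValue su2Rep 1 ((L : ℝ) ^ 3 * β) 0 ≤
              Real.exp (C * bareLambda ((L : ℝ) ^ 3 * β) ^ 2) * levelValue su2Rep 1 ((L : ℝ) ^ 3 * β) 1 *
                levelValue su2Rep L β 0 * l2 (fun U => ∑ i, a i * F i U) (fun U => ∑ i, a i * F i U)) :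
    NearFlatRatioLaw :=
  nearFlatRatioLaw_of_nearRegionTubeRatioLaw fun L _ hL =>
    GroundConc.nearRegionTubeRatioLawAt_of_innerRate hL (hI L hL) (GroundConc.groundState_outer_mass_le hL)

/-- ★★★ **K1 `NearFlatRatioLaw` from the Born–Oppenheimer data with rate** — the hypothesis is VERBATIM the body of `BORateAll`, the statement of the
single registered stub `stub_boRate` of crux `FixedLatticeLaw` 23943 (skeleton «rate»): floor with rate + adiabatic split (P1)(P3)(P4)(P5)(P6) at `k = 1`,
`δ = β^{−1/40}`, every `L ≥ 2`.  The door `innerRateAt_of_bo_pow 1` then `nearFlatRatioLaw_of_innerRate`.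
[cite: Luscher1983, §3] [cite: GustafsonSigal2003, §11–§12] -/
theorem nearFlatRatioLaw_of_boRate
    (hBO : ∀ (L : ℕ) [NeZero L], 2 ≤ L →
      ∃ C gap βB : ℝ, 0 < gap ∧ ∀ β : ℝ, βB ≤ β →
        ∃ N : ℝ, 0 < N ∧
          N * levelValue su2Rep 1 ((L : ℝ) ^ 3 * β) 0 * Real.exp (-(C * bareLambda ((L : ℝ) ^ 3 * β) ^ 2)) ≤ levelValue su2Rep L β 0 ∧
          ∀ G : Fin 2 → (GaugeConfig 3 L SU2 → ℝ),
            (∀ i, Measurable (G i)) → (∀ i, ∃ C' : ℝ, ∀ U, |G i U| ≤ C') →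
            (∀ i (g : Site 3 L → SU2) (U : GaugeConfig 3 L SU2), G i (gaugeTransform g U) = G i U) →
            (∀ i U, G i U ≠ 0 → orbitDist U < powScale (1 / 40) β) →
            ∃ (φ : Fin 2 → (GaugeConfig 3 L SU2 → ℝ)) (g : Fin 2 → (GaugeConfig 3 1 SU2 → ℝ)),
              (∀ i, Measurable (φ i)) ∧ (∀ i, ∃ C' : ℝ, ∀ U, |φ i U| ≤ C') ∧ (∀ i, IsPhys (g i)) ∧
              ∀ a : Fin 2 → ℝ,
                2 * |l2 (fun U => ∑ i, a i * φ i U) (fun U => ∑ i, a i * G i U - ∑ i, a i * φ i U)| ≤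
                    C * bareLambda ((L : ℝ) ^ 3 * β) ^ 2 *
                      (l2 (fun U => ∑ i, a i * φ i U) (fun U => ∑ i, a i * φ i U) +
                        l2 (fun U => ∑ i, a i * G i U - ∑ i, a i * φ i U) (fun U => ∑ i, a i * G i U - ∑ i, a i * φ i U)) ∧
                qform su2Rep β (fun U => ∑ i, a i * G i U - ∑ i, a i * φ i U) (fun U => ∑ i, a i * G i U - ∑ i, a i * φ i U) ≤
                    (1 - gap) * (N * levelValue su2Rep 1 ((L : ℝ) ^ 3 * β) 1) *
                      l2 (fun U => ∑ i, a i * G i U - ∑ i, a i * φ i U) (fun U => ∑ i, a i * G i U - ∑ i, a i * φ i U) ∧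
                qform su2Rep β (fun U => ∑ i, a i * φ i U) (fun U => ∑ i, a i * G i U - ∑ i, a i * φ i U) ^ 2 ≤
                    C * bareLambda ((L : ℝ) ^ 3 * β) ^ 2 * (N * levelValue su2Rep 1 ((L : ℝ) ^ 3 * β) 1) ^ 2 *
                      (l2 (fun U => ∑ i, a i * φ i U) (fun U => ∑ i, a i * φ i U) *
                        l2 (fun U => ∑ i, a i * G i U - ∑ i, a i * φ i U) (fun U => ∑ i, a i * G i U - ∑ i, a i * φ i U)) ∧
                qform su2Rep β (fun U => ∑ i, a i * φ i U) (fun U => ∑ i, a i * φ i U) ≤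
                    Real.exp (C * bareLambda ((L : ℝ) ^ 3 * β) ^ 2) * N *
                        qform su2Rep ((L : ℝ) ^ 3 * β) (fun U => ∑ i, a i * g i U) (fun U => ∑ i, a i * g i U) +
                      C * bareLambda ((L : ℝ) ^ 3 * β) ^ 2 * (N * levelValue su2Rep 1 ((L : ℝ) ^ 3 * β) 1) *
                        l2 (fun U => ∑ i, a i * φ i U) (fun U => ∑ i, a i * φ i U) ∧
                l2 (fun U => ∑ i, a i * g i U) (fun U => ∑ i, a i * g i U) ≤
                    Real.exp (C * bareLambda ((L : ℝ) ^ 3 * β) ^ 2) * l2 (fun U => ∑ i, a i * φ i U) (fun U => ∑ i, a i * φ i U)) :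
    NearFlatRatioLaw :=
  nearFlatRatioLaw_of_innerRate fun L _ hL => innerRateAt_of_bo_pow (L := L) 1 (by norm_num : (0 : ℝ) < 1 / 40) (hBO L hL)

end Summit.QuantumFields.YangMills.Theorems.FlatTubeReduction

end
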